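import Mathlib
import HarnessLib
import Summits.KontsevichZagierPeriods.Zeta5Search.Denom.CatalanRayPClosedAbs
import Summits.KontsevichZagierPeriods.Zeta5Search.CatalanTwoAdicQxi

/-!
# CatalanRayCoefAbs — exact puncture factorizations and numerator envelopes of the pole coefficients (fam-denom D9c, part 2)

HONEST FRAMING: systematic search; no irrationality claim unless certified.

fam-denom (pub-zeta5), `families/denom/PCLOSED-API.md` §T-G.  The pole coefficients of the explicit rational part are
`coef n J d = (½)_n · N(d) / (D₁(d) · D₂(d))` (`CatalanRayPClosed`).  This file proves the archimedean twins of the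
valuation lemmas `v_D1_beta`, `v_D2_neg`, … :
* exactly, `|D₂(−a)| = (a−1)!·(2n−a)!` (`1 ≤ a ≤ 2n`), `|D₁(−a)| = (a+J−n)!·(n−a)!` (`a ≤ n ≤ a+J`),
  `|D₁(−a)|·(a−n−1)! = (a+J−n)!` (`n < a`), `|D₁(c)| = (m−n)!·(c+n)!` and `|D₂(c)|·c! = (c+2n)!` (`J = m + c`, `n ≤ m`);
* the bounds `|N(−a)| ≤ (a+J)!·(n−a)!` (`a ≤ n`), `|N(−a)|·(a−n)! ≤ (a+J)!` (`n < a`), `|N(c)| ≤ m!·(c+n)!`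
  (each half-odd factor is bounded by the next integer);
* the factorial inequalities `x!·(y−k)! ≤ (x−k)!·y!` (`k ≤ x ≤ y`), `(n−1)!·n! ≤ (a−1)!·(2n−a)!` (`1 ≤ a ≤ 2n`) and the
  two KEY inequalities `key_coef_neg`, `key_coef_nat` that turn the factorizations into the envelope `n · C(J+2n, n)`.
The envelopes themselves (`abs_coef_neg_le`, `abs_coef_nat_le`, `abs_PClosed_le`, `abs_rayPClosed_le`) are in
`CatalanRayPClosedBound`.
-/

namespace Summit.KontsevichZagierPeriods.Zeta5Search.Denom.CatalanRayPClosed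

open Finset
open Summit.KontsevichZagierPeriods.Zeta5Search.Denom.CatalanRayAtoms

/-! ### Products as factorials -/

/-- `(∏_{i<M} (r+i+1)) · r! = (r+M)!` in `ℚ`. -/
theorem prod_shift_mul_factorial (r M : ℕ) :
    (∏ i ∈ range M, ((r : ℚ) + i + 1)) * (r.factorial : ℚ) = ((r + M).factorial : ℚ) := by
  induction M with
  | zero => simp
  | succ M ih =>
    rw [Finset.prod_range_succ, show r + (M + 1) = (r + M) + 1 by ring, Nat.factorial_succ]
    push_cast
    rw [← ih]; ring

/-! ### The punctured denominators, exactly -/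

/-- `|D₂(−a)| = (a−1)!·(2n−a)!` for `1 ≤ a ≤ 2n`. -/
theorem abs_D2_neg (n a : ℕ) (ha1 : 1 ≤ a) (ha2 : a ≤ 2 * n) :
    |D2 n (-(a : ℚ))| = (((a - 1).factorial * (2 * n - a).factorial : ℕ) : ℚ) := by
  obtain ⟨b, rfl⟩ : ∃ b, a = b + 1 := ⟨a - 1, by omega⟩
  obtain ⟨t, ht⟩ : ∃ t, 2 * n = b + (1 + t) := ⟨2 * n - b - 1, by omega⟩
  rw [show b + 1 - 1 = b by omega, show 2 * n - (b + 1) = t by omega]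
  unfold D2
  rw [Finset.abs_prod, ht, Finset.prod_range_add, Finset.prod_range_add,
    ← Finset.prod_range_reflect (fun i => |skip (-((b + 1 : ℕ) : ℚ) + (i : ℕ) + 1)|) b]
  have hmid : |skip (-((b + 1 : ℕ) : ℚ) + ((b + 0 : ℕ) : ℚ) + 1)| = 1 := by
    rw [show (-((b + 1 : ℕ) : ℚ) + ((b + 0 : ℕ) : ℚ) + 1) = 0 by push_cast; ring]; simp [skip]
  rw [Finset.prod_range_one, hmid, one_mul]
  have hA : ∏ j ∈ range b, |skip (-((b + 1 : ℕ) : ℚ) + ((b - 1 - j : ℕ) : ℚ) + 1)|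
      = ∏ j ∈ range b, ((j : ℚ) + 1) := by
    refine Finset.prod_congr rfl (fun i hi => ?_)
    rw [Finset.mem_range] at hi
    obtain ⟨k, hk⟩ : ∃ k, b = i + k + 1 := ⟨b - 1 - i, by omega⟩
    rw [show b - 1 - i = k by omega,
      show -((b + 1 : ℕ) : ℚ) + (k : ℕ) + 1 = -((i : ℚ) + 1) by rw [hk]; push_cast; ring,
      skip, if_neg (neg_ne_zero.mpr (by positivity)), abs_neg, abs_of_nonneg (by positivity)]
  have hC : ∏ i ∈ range t, |skip (-((b + 1 : ℕ) : ℚ) + ((b + (1 + i) : ℕ) : ℚ) + 1)|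
      = ∏ i ∈ range t, ((i : ℚ) + 1) := by
    refine Finset.prod_congr rfl (fun i _ => ?_)
    rw [show -((b + 1 : ℕ) : ℚ) + ((b + (1 + i) : ℕ) : ℚ) + 1 = (i : ℚ) + 1 by push_cast; ring,
      skip, if_neg (by positivity), abs_of_nonneg (by positivity)]
  rw [hA, hC, CatalanTwoAdicSeries.prod_range_add_one_cast, CatalanTwoAdicSeries.prod_range_add_one_cast]; push_cast; ring

/-- `|D₁(−a)| = (a+J−n)!·(n−a)!` for `a ≤ n ≤ a + J`. -/
theorem abs_D1_beta (n J a : ℕ) (ha : a ≤ n) (hn : n ≤ a + J) :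
    |D1 n J (-(a : ℚ))| = (((a + J - n).factorial * (n - a).factorial : ℕ) : ℚ) := by
  obtain ⟨r, rfl⟩ : ∃ r, n = a + r := ⟨n - a, by omega⟩
  obtain ⟨s, rfl⟩ : ∃ s, J = r + s := ⟨J - r, by omega⟩
  rw [show a + (r + s) - (a + r) = s by omega, show a + r - a = r by omega]
  unfold D1
  rw [Finset.abs_prod, show r + s + 1 = s + (1 + r) by ring, Finset.prod_range_add, Finset.prod_range_add,
    ← Finset.prod_range_reflect (fun i => |skip (-(a : ℚ) - ((r + s : ℕ) : ℚ) + ((a + r : ℕ) : ℚ) + (i : ℕ))|) s]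
  have hmid : |skip (-(a : ℚ) - ((r + s : ℕ) : ℚ) + ((a + r : ℕ) : ℚ) + ((s + 0 : ℕ) : ℚ))| = 1 := by
    rw [show (-(a : ℚ) - ((r + s : ℕ) : ℚ) + ((a + r : ℕ) : ℚ) + ((s + 0 : ℕ) : ℚ)) = 0 by push_cast; ring]
    simp [skip]
  rw [Finset.prod_range_one, hmid, one_mul]
  have hA : ∏ j ∈ range s, |skip (-(a : ℚ) - ((r + s : ℕ) : ℚ) + ((a + r : ℕ) : ℚ) + ((s - 1 - j : ℕ) : ℚ))|
      = ∏ j ∈ range s, ((j : ℚ) + 1) := by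
    refine Finset.prod_congr rfl (fun i hi => ?_)
    rw [Finset.mem_range] at hi
    obtain ⟨k, hk⟩ : ∃ k, s = i + k + 1 := ⟨s - 1 - i, by omega⟩
    rw [show s - 1 - i = k by omega,
      show -(a : ℚ) - ((r + s : ℕ) : ℚ) + ((a + r : ℕ) : ℚ) + (k : ℕ) = -((i : ℚ) + 1) by rw [hk]; push_cast; ring,
      skip, if_neg (neg_ne_zero.mpr (by positivity)), abs_neg, abs_of_nonneg (by positivity)]
  have hC : ∏ i ∈ range r, |skip (-(a : ℚ) - ((r + s : ℕ) : ℚ) + ((a + r : ℕ) : ℚ) + ((s + (1 + i) : ℕ) : ℚ))|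
      = ∏ i ∈ range r, ((i : ℚ) + 1) := by
    refine Finset.prod_congr rfl (fun i _ => ?_)
    rw [show -(a : ℚ) - ((r + s : ℕ) : ℚ) + ((a + r : ℕ) : ℚ) + ((s + (1 + i) : ℕ) : ℚ) = (i : ℚ) + 1 by push_cast; ring,
      skip, if_neg (by positivity), abs_of_nonneg (by positivity)]
  rw [hA, hC, CatalanTwoAdicSeries.prod_range_add_one_cast, CatalanTwoAdicSeries.prod_range_add_one_cast]; push_cast; ring

/-- `|D₁(−a)|·(a−n−1)! = (a+J−n)!` for `n < a`. -/
theorem abs_D1_gamma (n J a : ℕ) (hna : n < a) :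
    |D1 n J (-(a : ℚ))| * ((a - n - 1).factorial : ℚ) = ((a + J - n).factorial : ℚ) := by
  obtain ⟨r, rfl⟩ : ∃ r, a = n + r + 1 := ⟨a - n - 1, by omega⟩
  rw [show n + r + 1 + J - n = r + (J + 1) by omega, show n + r + 1 - n - 1 = r by omega]
  unfold D1
  rw [Finset.abs_prod,
    ← Finset.prod_range_reflect (fun i => |skip (-((n + r + 1 : ℕ) : ℚ) - (J : ℚ) + (n : ℚ) + (i : ℕ))|) (J + 1)]
  have hA : ∏ j ∈ range (J + 1), |skip (-((n + r + 1 : ℕ) : ℚ) - (J : ℚ) + (n : ℚ) + ((J + 1 - 1 - j : ℕ) : ℚ))|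
      = ∏ j ∈ range (J + 1), ((r : ℚ) + j + 1) := by
    refine Finset.prod_congr rfl (fun i hi => ?_)
    rw [Finset.mem_range] at hi
    obtain ⟨k, hk⟩ : ∃ k, J = i + k := ⟨J - i, by omega⟩
    rw [show J + 1 - 1 - i = k by omega,
      show -((n + r + 1 : ℕ) : ℚ) - (J : ℚ) + (n : ℚ) + (k : ℕ) = -((r : ℚ) + i + 1) by rw [hk]; push_cast; ring,
      skip, if_neg (neg_ne_zero.mpr (by positivity)), abs_neg, abs_of_nonneg (by positivity)]
  rw [hA, prod_shift_mul_factorial]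

/-- `|D₁(c)| = (m−n)!·(c+n)!` at a pole `T = c`, `J = m + c`, `n ≤ m`. -/
theorem abs_D1_alpha (n m c : ℕ) (hmn : n ≤ m) :
    |D1 n (m + c) c| = (((m - n).factorial * (c + n).factorial : ℕ) : ℚ) := by
  unfold D1
  rw [Finset.abs_prod, show m + c + 1 = (m - n) + (1 + (c + n)) by omega,
    Finset.prod_range_add, Finset.prod_range_add,
    ← Finset.prod_range_reflect (fun i => |skip ((c : ℚ) - ((m + c : ℕ) : ℚ) + n + (i : ℕ))|) (m - n)]
  have hmid : |skip ((c : ℚ) - ((m + c : ℕ) : ℚ) + n + (((m - n) + 0 : ℕ) : ℚ))| = 1 := by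
    rw [show (c : ℚ) - ((m + c : ℕ) : ℚ) + n + (((m - n) + 0 : ℕ) : ℚ) = 0 by
      obtain ⟨k, hk⟩ : ∃ k, m = n + k := ⟨m - n, by omega⟩
      rw [show m - n = k by omega, hk]; push_cast; ring]
    simp [skip]
  rw [Finset.prod_range_one, hmid, one_mul]
  have hA : ∏ j ∈ range (m - n), |skip ((c : ℚ) - ((m + c : ℕ) : ℚ) + n + ((m - n - 1 - j : ℕ) : ℚ))|
      = ∏ j ∈ range (m - n), ((j : ℚ) + 1) := by
    refine Finset.prod_congr rfl (fun i hi => ?_)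
    rw [Finset.mem_range] at hi
    obtain ⟨k, hk⟩ : ∃ k, m = n + i + k + 1 := ⟨m - n - 1 - i, by omega⟩
    have e : (c : ℚ) - ((m + c : ℕ) : ℚ) + n + ((m - n - 1 - i : ℕ) : ℚ) = -((i : ℚ) + 1) := by
      rw [show m - n - 1 - i = k by omega, hk]; push_cast; ring
    rw [e, skip, if_neg (neg_ne_zero.mpr (by positivity)), abs_neg, abs_of_nonneg (by positivity)]
  have hC : ∏ i ∈ range (c + n), |skip ((c : ℚ) - ((m + c : ℕ) : ℚ) + n + (((m - n) + (1 + i) : ℕ) : ℚ))|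
      = ∏ i ∈ range (c + n), ((i : ℚ) + 1) := by
    refine Finset.prod_congr rfl (fun i _ => ?_)
    have e : (c : ℚ) - ((m + c : ℕ) : ℚ) + n + (((m - n) + (1 + i) : ℕ) : ℚ) = (i : ℚ) + 1 := by
      obtain ⟨k, hk⟩ : ∃ k, m = n + k := ⟨m - n, by omega⟩
      rw [show m - n = k by omega, hk]; push_cast; ring
    rw [e, skip, if_neg (by positivity), abs_of_nonneg (by positivity)]
  rw [hA, hC, CatalanTwoAdicSeries.prod_range_add_one_cast, CatalanTwoAdicSeries.prod_range_add_one_cast]; push_cast; ring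

/-- `|D₂(c)|·c! = (c+2n)!` at a pole `T = c ≥ 0`. -/
theorem abs_D2_alpha (n c : ℕ) : |D2 n c| * (c.factorial : ℚ) = ((c + 2 * n).factorial : ℚ) := by
  unfold D2
  rw [Finset.abs_prod]
  have h : ∏ e ∈ range (2 * n), |skip ((c : ℚ) + (e : ℕ) + 1)| = ∏ e ∈ range (2 * n), ((c : ℚ) + e + 1) := by
    refine Finset.prod_congr rfl (fun e _ => ?_)
    rw [skip, if_neg (by positivity), abs_of_nonneg (by positivity)]
  rw [h, prod_shift_mul_factorial]

/-! ### The numerators, bounded -/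

/-- `|N(−a)| ≤ (a+J)!·(n−a)!` for `a ≤ n`. -/
theorem abs_Nnum_beta_le (n J a : ℕ) (ha : a ≤ n) :
    |Nnum n J (-(a : ℚ))| ≤ ((a + J).factorial : ℚ) * ((n - a).factorial : ℚ) := by
  obtain ⟨r, rfl⟩ : ∃ r, n = a + r := ⟨n - a, by omega⟩
  rw [show a + r - a = r by omega]
  unfold Nnum
  rw [Finset.abs_prod, show J + (a + r) = (a + J) + r by ring, Finset.prod_range_add,
    ← Finset.prod_range_reflect (fun i => |(-(a : ℚ) - (J : ℚ) + 1 / 2 + (i : ℕ))|) (a + J)]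
  have h1 : ∏ j ∈ range (a + J), |(-(a : ℚ) - (J : ℚ) + 1 / 2 + ((a + J - 1 - j : ℕ) : ℚ))|
      ≤ ∏ j ∈ range (a + J), ((j : ℚ) + 1) := by
    apply Finset.prod_le_prod (fun j _ => abs_nonneg _)
    intro j hj
    rw [Finset.mem_range] at hj
    obtain ⟨k, hk⟩ : ∃ k, a + J = j + k + 1 := ⟨a + J - 1 - j, by omega⟩
    have hk' : (a : ℚ) + J = j + k + 1 := by exact_mod_cast hk
    rw [show a + J - 1 - j = k by omega,
      show -(a : ℚ) - (J : ℚ) + 1 / 2 + (k : ℕ) = -((j : ℚ) + 1 / 2) by linarith,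
      abs_neg, abs_of_nonneg (by positivity)]
    linarith
  have h2 : ∏ i ∈ range r, |(-(a : ℚ) - (J : ℚ) + 1 / 2 + ((a + J + i : ℕ) : ℚ))| ≤ ∏ i ∈ range r, ((i : ℚ) + 1) := by
    apply Finset.prod_le_prod (fun i _ => abs_nonneg _)
    intro i _
    rw [show -(a : ℚ) - (J : ℚ) + 1 / 2 + ((a + J + i : ℕ) : ℚ) = (i : ℚ) + 1 / 2 by push_cast; ring,
      abs_of_nonneg (by positivity)]
    linarith
  rw [CatalanTwoAdicSeries.prod_range_add_one_cast] at h1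
  rw [CatalanTwoAdicSeries.prod_range_add_one_cast] at h2
  exact mul_le_mul h1 h2 (Finset.prod_nonneg fun _ _ => abs_nonneg _) (by positivity)

/-- `|N(−a)|·(a−n)! ≤ (a+J)!` for `n < a`. -/
theorem abs_Nnum_gamma_le (n J a : ℕ) (hna : n < a) :
    |Nnum n J (-(a : ℚ))| * ((a - n).factorial : ℚ) ≤ ((a + J).factorial : ℚ) := by
  obtain ⟨r, rfl⟩ : ∃ r, a = n + r := ⟨a - n, by omega⟩
  rw [show n + r - n = r by omega]
  unfold Nnum
  rw [Finset.abs_prod,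
    ← Finset.prod_range_reflect (fun i => |(-((n + r : ℕ) : ℚ) - (J : ℚ) + 1 / 2 + (i : ℕ))|) (J + n)]
  have h1 : ∏ j ∈ range (J + n), |(-((n + r : ℕ) : ℚ) - (J : ℚ) + 1 / 2 + ((J + n - 1 - j : ℕ) : ℚ))|
      ≤ ∏ j ∈ range (J + n), ((r : ℚ) + j + 1) := by
    apply Finset.prod_le_prod (fun j _ => abs_nonneg _)
    intro j hj
    rw [Finset.mem_range] at hj
    obtain ⟨k, hk⟩ : ∃ k, J + n = j + k + 1 := ⟨J + n - 1 - j, by omega⟩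
    have hk' : (J : ℚ) + n = j + k + 1 := by exact_mod_cast hk
    rw [show J + n - 1 - j = k by omega,
      show -((n + r : ℕ) : ℚ) - (J : ℚ) + 1 / 2 + (k : ℕ) = -((r : ℚ) + j + 1 / 2) by push_cast; linarith,
      abs_neg, abs_of_nonneg (by positivity)]
    linarith
  calc (∏ j ∈ range (J + n), |(-((n + r : ℕ) : ℚ) - (J : ℚ) + 1 / 2 + ((J + n - 1 - j : ℕ) : ℚ))|) * (r.factorial : ℚ)
      ≤ (∏ j ∈ range (J + n), ((r : ℚ) + j + 1)) * (r.factorial : ℚ) :=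
        mul_le_mul_of_nonneg_right h1 (by positivity)
    _ = ((r + (J + n)).factorial : ℚ) := prod_shift_mul_factorial r (J + n)
    _ = ((n + r + J).factorial : ℚ) := by rw [show r + (J + n) = n + r + J by ring]

/-- `|N(c)| ≤ m!·(c+n)!` at a pole `T = c`, `J = m + c`. -/
theorem abs_Nnum_alpha_le (n m c : ℕ) :
    |Nnum n (m + c) c| ≤ (m.factorial : ℚ) * ((c + n).factorial : ℚ) := by
  unfold Nnum
  rw [Finset.abs_prod, show m + c + n = m + (c + n) by ring, Finset.prod_range_add,
    ← Finset.prod_range_reflect (fun i => |((c : ℚ) - ((m + c : ℕ) : ℚ) + 1 / 2 + (i : ℕ))|) m]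
  have h1 : ∏ j ∈ range m, |((c : ℚ) - ((m + c : ℕ) : ℚ) + 1 / 2 + ((m - 1 - j : ℕ) : ℚ))|
      ≤ ∏ j ∈ range m, ((j : ℚ) + 1) := by
    apply Finset.prod_le_prod (fun j _ => abs_nonneg _)
    intro j hj
    rw [Finset.mem_range] at hj
    obtain ⟨k, hk⟩ : ∃ k, m = j + k + 1 := ⟨m - 1 - j, by omega⟩
    rw [show m - 1 - j = k by omega,
      show (c : ℚ) - ((m + c : ℕ) : ℚ) + 1 / 2 + (k : ℕ) = -((j : ℚ) + 1 / 2) by rw [hk]; push_cast; ring,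
      abs_neg, abs_of_nonneg (by positivity)]
    linarith
  have h2 : ∏ i ∈ range (c + n), |((c : ℚ) - ((m + c : ℕ) : ℚ) + 1 / 2 + ((m + i : ℕ) : ℚ))|
      ≤ ∏ i ∈ range (c + n), ((i : ℚ) + 1) := by
    apply Finset.prod_le_prod (fun i _ => abs_nonneg _)
    intro i _
    rw [show (c : ℚ) - ((m + c : ℕ) : ℚ) + 1 / 2 + ((m + i : ℕ) : ℚ) = (i : ℚ) + 1 / 2 by push_cast; ring,
      abs_of_nonneg (by positivity)]
    linarith
  rw [CatalanTwoAdicSeries.prod_range_add_one_cast] at h1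
  rw [CatalanTwoAdicSeries.prod_range_add_one_cast] at h2
  exact mul_le_mul h1 h2 (Finset.prod_nonneg fun _ _ => abs_nonneg _) (by positivity)

/-! ### Factorial inequalities (in `ℕ`) -/

/-- `x!·(y−k)! ≤ (x−k)!·y!` for `k ≤ x ≤ y` (monotonicity of the falling factorial). -/
theorem factorial_mul_le_desc (x y k : ℕ) (hk : k ≤ x) (hxy : x ≤ y) :
    x.factorial * (y - k).factorial ≤ (x - k).factorial * y.factorial := by
  have h1 : (x - k).factorial * x.descFactorial k = x.factorial := Nat.factorial_mul_descFactorial hk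
  have h2 : (y - k).factorial * y.descFactorial k = y.factorial := Nat.factorial_mul_descFactorial (by omega)
  have h3 : x.descFactorial k ≤ y.descFactorial k := Nat.descFactorial_le k hxy
  calc x.factorial * (y - k).factorial = (x - k).factorial * x.descFactorial k * (y - k).factorial := by rw [h1]
    _ ≤ (x - k).factorial * y.descFactorial k * (y - k).factorial := by gcongr
    _ = (x - k).factorial * ((y - k).factorial * y.descFactorial k) := by ring
    _ = (x - k).factorial * y.factorial := by rw [h2]

/-- `(n−1)!·n! ≤ (a−1)!·(2n−a)!` for `1 ≤ a ≤ 2n` (the balanced split is the smallest). -/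
theorem factorial_pred_mul_le (n a : ℕ) (ha1 : 1 ≤ a) (ha2 : a ≤ 2 * n) :
    (n - 1).factorial * n.factorial ≤ (a - 1).factorial * (2 * n - a).factorial := by
  rcases le_or_gt a n with h | h
  · -- `a − 1 = (n−1) − m`, `2n − a = n + m`, `m = n − a`
    have := factorial_mul_le_desc (n - 1) (n + (n - a)) (n - a) (by omega) (by omega)
    rw [show n + (n - a) - (n - a) = n by omega, show n - 1 - (n - a) = a - 1 by omega,
      show n + (n - a) = 2 * n - a by omega] at this
    exact this
  · -- `2n − a = (n−1) − m`, `a − 1 = n + m`, `m = a − n − 1`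
    have := factorial_mul_le_desc (n - 1) (n + (a - n - 1)) (a - n - 1) (by omega) (by omega)
    rw [show n + (a - n - 1) - (a - n - 1) = n by omega, show n - 1 - (a - n - 1) = 2 * n - a by omega,
      show n + (a - n - 1) = a - 1 by omega] at this
    rw [mul_comm ((a - 1).factorial)]
    exact this

/-- KEY (poles `T = −a`): `n!·n!·(a+J)!·(J+n)! ≤ n · (J+2n)! · (a+J−n)! · (a−1)! · (2n−a)!`. -/
theorem key_coef_neg (n J a : ℕ) (hn : 1 ≤ n) (ha1 : 1 ≤ a) (ha2 : a ≤ 2 * n) (hJ : n ≤ J) :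
    n.factorial * n.factorial * (a + J).factorial * (J + n).factorial
      ≤ n * ((J + 2 * n).factorial * ((a + J - n).factorial * ((a - 1).factorial * (2 * n - a).factorial))) := by
  have h1 : n.factorial * n.factorial ≤ n * ((a - 1).factorial * (2 * n - a).factorial) := by
    have e : n.factorial = n * (n - 1).factorial := by
      obtain ⟨k, rfl⟩ : ∃ k, n = k + 1 := ⟨n - 1, by omega⟩
      rw [Nat.factorial_succ]; simp
    calc n.factorial * n.factorial = n * ((n - 1).factorial * n.factorial) := by rw [e]; ring
      _ ≤ n * ((a - 1).factorial * (2 * n - a).factorial) :=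
          Nat.mul_le_mul_left _ (factorial_pred_mul_le n a ha1 ha2)
  have h2 : (a + J).factorial * (J + n).factorial ≤ (a + J - n).factorial * (J + 2 * n).factorial := by
    have := factorial_mul_le_desc (a + J) (J + 2 * n) n (by omega) (by omega)
    rwa [show J + 2 * n - n = J + n by omega] at this
  calc n.factorial * n.factorial * (a + J).factorial * (J + n).factorial
      = (n.factorial * n.factorial) * ((a + J).factorial * (J + n).factorial) := by ring
    _ ≤ (n * ((a - 1).factorial * (2 * n - a).factorial)) * ((a + J - n).factorial * (J + 2 * n).factorial) :=
        Nat.mul_le_mul h1 h2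
    _ = n * ((J + 2 * n).factorial * ((a + J - n).factorial * ((a - 1).factorial * (2 * n - a).factorial))) := by ring

/-- KEY (poles `T = c`, `J = m + c`): `n!·n!·m!·c!·(J+n)! ≤ n · (J+2n)! · (m−n)! · (c+2n)!`. -/
theorem key_coef_nat (n m c : ℕ) (hn : 1 ≤ n) (hmn : n ≤ m) :
    n.factorial * n.factorial * m.factorial * c.factorial * (m + c + n).factorial
      ≤ n * ((m + c + 2 * n).factorial * ((m - n).factorial * (c + 2 * n).factorial)) := by
  have h1 : n.factorial * n.factorial * c.factorial ≤ n * (c + 2 * n).factorial := by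
    have e1 : n.factorial * n.factorial ≤ (n + n).factorial :=
      Nat.le_of_dvd (Nat.factorial_pos _) (Nat.factorial_mul_factorial_dvd_factorial_add n n)
    have e2 : c.factorial * (2 * n).factorial ≤ (c + 2 * n).factorial :=
      Nat.le_of_dvd (Nat.factorial_pos _) (Nat.factorial_mul_factorial_dvd_factorial_add c (2 * n))
    rw [show n + n = 2 * n by ring] at e1
    calc n.factorial * n.factorial * c.factorial ≤ (2 * n).factorial * c.factorial := Nat.mul_le_mul_right _ e1
      _ = c.factorial * (2 * n).factorial := by ring
      _ ≤ (c + 2 * n).factorial := e2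
      _ ≤ n * (c + 2 * n).factorial := Nat.le_mul_of_pos_left _ (by omega)
  have h2 : m.factorial * (m + c + n).factorial ≤ (m - n).factorial * (m + c + 2 * n).factorial := by
    have := factorial_mul_le_desc m (m + c + 2 * n) n hmn (by omega)
    rwa [show m + c + 2 * n - n = m + c + n by omega] at this
  calc n.factorial * n.factorial * m.factorial * c.factorial * (m + c + n).factorial
      = (n.factorial * n.factorial * c.factorial) * (m.factorial * (m + c + n).factorial) := by ring
    _ ≤ (n * (c + 2 * n).factorial) * ((m - n).factorial * (m + c + 2 * n).factorial) := Nat.mul_le_mul h1 h2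
    _ = n * ((m + c + 2 * n).factorial * ((m - n).factorial * (c + 2 * n).factorial)) := by ring

end Summit.KontsevichZagierPeriods.Zeta5Search.Denom.CatalanRayPClosed
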